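import Summits.NavierStokesRegularity.NavierStokesRegularity.Theorems.OddMorawetzLocal.Negative.OddMorawetzLocalRefutationData3
import Summits.NavierStokesRegularity.NavierStokesRegularity.Theorems.OddMorawetzLocal.Negative.OddMorawetzLocalRefutationDefsIV
import HarnessLib

/-!
# Crux `OddMorawetzLocal` (stmt-NavierStokesRegularity-1376) — kernel certificates, weight 3 (part A)

The finite computations of the weight-3 half of the refutation, each a closed Boolean evaluated by the kernel
(`decide +kernel`) on the vocabulary of `OddMorawetzLocalJetAlgebra` / `…RefutationDefs{,Fast,IV}` and the literal
data of `…RefutationData3`.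
Part A: `cert3_e1_*` — the orbit-sum identities `e1Check 3 reps3 lo n` on all 831 basis monomials (step E1: a `B₃`-fixed
coefficient vector lies in the span of the 40 normalised orbit sums), in chunks of ≤ 100 monomials (kernel memory), and
the size bookkeeping `cert3_sizes`.
No analysis; lands `--supports` the crux item; consumed by the weight-3 assembly (steps E1/E2/null of the refutation).
-/

set_option linter.dupNamespace false

namespace Summit.NavierStokesRegularity.NavierStokesRegularity.Theorems.OddMorawetz

/-- Orbit-sum identities for the basis monomials `0 … 99`. -/
theorem cert3_e1_0 : e1Check 3 reps3 0 100 = true := by decide +kernel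

/-- Orbit-sum identities for the basis monomials `100 … 199`. -/
theorem cert3_e1_1 : e1Check 3 reps3 100 100 = true := by decide +kernel

/-- Orbit-sum identities for the basis monomials `200 … 299`. -/
theorem cert3_e1_2 : e1Check 3 reps3 200 100 = true := by decide +kernel

/-- Orbit-sum identities for the basis monomials `300 … 399`. -/
theorem cert3_e1_3 : e1Check 3 reps3 300 100 = true := by decide +kernel

/-- Orbit-sum identities for the basis monomials `400 … 499`. -/
theorem cert3_e1_4 : e1Check 3 reps3 400 100 = true := by decide +kernel

/-- Orbit-sum identities for the basis monomials `500 … 599`. -/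
theorem cert3_e1_5 : e1Check 3 reps3 500 100 = true := by decide +kernel

/-- Orbit-sum identities for the basis monomials `600 … 699`. -/
theorem cert3_e1_6 : e1Check 3 reps3 600 100 = true := by decide +kernel

/-- Orbit-sum identities for the basis monomials `700 … 799`. -/
theorem cert3_e1_7 : e1Check 3 reps3 700 100 = true := by decide +kernel

/-- Orbit-sum identities for the basis monomials `800 … 830`. -/
theorem cert3_e1_8 : e1Check 3 reps3 800 31 = true := by decide +kernel

/-- Size bookkeeping of the weight-3 data: 831 basis monomials, 40 representatives, 17 isotropic basis elements,
certificate blocks of sizes 6, 12, 5 (rows and columns), 17 columns / rows in the independence certificate. -/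
theorem cert3_sizes : (idx 3).length = 831 ∧ reps3.length = 40 ∧ isoDesc3.length = 17 ∧
    (blocks3.map fun b => b.1.length) = [6, 12, 5] ∧ (blocks3.map fun b => b.2.1.length) = [6, 12, 5] ∧
    (certRows blocks3).length = 23 ∧ (certCols blocks3).length = 23 ∧ kcols3.length = 17 ∧ cinv3.length = 17 := by
  decide +kernel

end Summit.NavierStokesRegularity.NavierStokesRegularity.Theorems.OddMorawetz
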